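import Summits.QuantumFields.YangMills.Theorems.BalabanUVNodesN21AtSpineCarriersMixtureCommonBox

/-!
# YM-DAG node N21 (= NE7c) — THE THRESHOLD MIXTURE, PART 4c: vacuity guard for the common-box reading — a two-term DECOMPOSITION OF UNITY
# sharing ONE occurrence inhabits `s_N21_of_sharpCommonBoxReading`'s package non-degenerately, and `S_N21` FIRES on it

Track A of `YM-PLAN.md` (cell `pub-ymgap`, HUMAN RULING D-0062), node **N21**; R141 (C) fan-out seat `pub-ymgap-dag-n21-e` (s3 = ALTERNATIVE
CURRENCY), generation 3, file 10c (guard of file 10b `…N21AtSpineCarriersMixtureCommonBox`, p-id in the bus line).  Kernel bookkeeping on a TOY: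
0 `def`, 0 `sorry`, standard axioms.  COUNT-NEUTRAL; `--supports` the K3′ item `SpineGivenEndpointR12` as a helper.

THE TOY (A2 junk-pin guard: the ∃-package of file 10b §2 is jointly satisfiable with nonempty classes, positive carriers, non-trivial shell
parts, and the common box used NON-trivially).  Per step `K`: ONE occurrence (`nC ≡ 1`, age `0`, nominal threshold `1`, width `κ = 1∕2`) read by
TWO terms — `true ↦ χ` (small polarity) and `false ↦ 1 − χ` (large polarity), coordinate maps `e K τ = id` (both terms read the SAME multiplier);
point space with the Dirac mass, remainder `1`; run A tests `3∕4`, run B `3∕4 + (1∕2)^K∕8` (pv07's toy numbers, `T4LipschitzLedger.Sanity`).  Then: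
the carriers `A ≡ 1∕2`, `B = 1∕2 ∓ (1∕2)^K∕4` ARE the normalised threshold averages of the sharp weights (`toy_average`, EITHER polarity); the SHARP
class total `1[u < s] + (1 − 1[u < s]) = 1` is threshold-INDEPENDENT (`toy_sum_sharp`) and each sharp sibling weight is `≤ 1`
(`toy_sharpSibling_le_one`), so the SHARP class-relative sibling bound holds with `Ssup ≡ 2` at EVERY threshold of the common box; `SupClose` with
pv07's width `(1∕2)^j∕8`; run A's realized shell part is `(1∕2)^K∕4 > 0` in the `χ`-term and run B's is `(1∕2)^K∕4 > 0` in the `1 − χ`-term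
(`toy_shell_true_A`, `toy_shell_false_B`); record weight `(1∕2)^K∕2` (`toy_bandWeight₂`).  A toy, NOT Bałaban's terms.

HONEST FRAMING.  Nothing of Bałaban's is asserted; NE7c NOT PRINTED ∕ NOT proved; N21 NOT discharged; count-neutral; one finite four-torus
programme at fixed `ε`; NOT continuum ∕ ℝ⁴ ∕ OS ∕ mass gap ∕ Clay.

CITATION HEADER (lean-in-tree rule 2026-08-18).  BY NAME: file 10b `s_N21_of_sharpCommonBoxReading`; file 5a `sharpMixture_prod_eq_profile_prod`;
file 9 `prod_ite_fac_smallInd_mem_unitInterval`; `T4LipschitzCutoff.linProfile` ∕ `lipWeight` ∕ `minPiece`; `T4LipschitzLedger.SupClose` ∕ `shellW` ∕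
`pieceAt` ∕ `facAt` ∕ `Pol` and pv07's toy letters `T4LipschitzLedger.Sanity.ρ ∕ summable_ρ ∕ half_pow_pos ∕ half_pow_le_one ∕ profile_A ∕ profile_B`;
`T4IndicatorShell.smallInd`; `…ClustersCore` (`SpineCarriers`, `SpineRecordPred`, `S_N21`); `…N21AtSpineCarriers.exists_family_and_datum`.

WHAT IS PROVED ([folklore]).  `toy_average`, `toy_sum_sharp`, `toy_sharpSibling_le_one`, `toy_shell_true_A`, `toy_shell_false_B`, `toy_bandWeight₂`,
**`s_N21_fires_on_sharpCommonBoxReading`**.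
-/

set_option autoImplicit false

noncomputable section

open MeasureTheory Set
open scoped BigOperators ENNReal

namespace Summit.QuantumFields.YangMills.Theorems.N21AtSpineCarriersMixtureCommonBoxSanity

open YMDAG.UVSplit (SpineCarriers SpineRecordPred S_N21)
open Literature.MathematicalPhysics.QuantumFieldTheory.Balaban1983to89
open Literature.MathematicalPhysics.QuantumFieldTheory.Balaban1983to89.T4LipschitzCutoff
open Literature.MathematicalPhysics.QuantumFieldTheory.Balaban1983to89.T4IndicatorShell
open Literature.MathematicalPhysics.QuantumFieldTheory.Balaban1983to89.T4LipschitzLedger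
open N21ThresholdMixture (sharpMixture_prod_eq_profile_prod)
open N21ThresholdMixtureSibling (prod_ite_fac_smallInd_mem_unitInterval)
open N21AtSpineCarriersMixtureCommonBox (s_N21_of_sharpCommonBoxReading)

/-! ## The two-term decomposition of unity sharing ONE occurrence: the reading is inhabited and `S_N21` FIRES on it -/

section NonVacuity

open T4LipschitzLedger.Sanity (half_pow_pos half_pow_le_one profile_A profile_B summable_ρ)

/-- THE ONE-OCCURRENCE MIXTURE IDENTITY behind the toy, EITHER polarity: the normalised average over `s ∈ [1∕2, 1]` of the sharp factor
`p.fac (1[u < s])` (point space, remainder `1`) is the profile factor `p.fac (linProfile (1∕2) u)` (file 5a's `sharpMixture_prod_eq_profile_prod`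
at `m = 1`). [folklore] -/
theorem toy_average (p : Pol) (u : ℝ) :
    (∏ _i : Fin 1, ((1 / 2 : ℝ) * 1))⁻¹ *
        ∫ s : Fin 1 → ℝ, (∫ _v : Unit, (∏ i : Fin 1, p.fac (smallInd u (s i))) * (1 : ℝ) ∂(Measure.dirac ()))
          ∂(Measure.pi fun _ : Fin 1 => volume.restrict (Icc ((1 - (1 / 2 : ℝ)) * 1) 1)) =
      p.fac (linProfile (1 / 2) (u / 1)) := by
  have h := sharpMixture_prod_eq_profile_prod (m := 1) (fun _ => p) (fun _ => (1 / 2 : ℝ)) (fun _ => (1 : ℝ)) (fun _ => u)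
    (fun _ => by norm_num) (fun _ => by norm_num)
  simp only [integral_dirac, mul_one, Fin.prod_univ_one] at h ⊢
  rw [h, inv_mul_cancel_left₀ (by norm_num : (1 / 2 : ℝ) ≠ 0)]

/-- THE SHARP CLASS TOTAL OF THE DECOMPOSITION OF UNITY IS THRESHOLD-INDEPENDENT: `1[u < s] + (1 − 1[u < s]) = 1`. [folklore] -/
theorem toy_sum_sharp (u s : ℝ) : ∑ b : Bool, (cond b Pol.small Pol.large).fac (smallInd u s) = 1 := by
  rw [Fintype.sum_bool]
  simp only [Bool.cond_true, Bool.cond_false, Pol.fac_small, Pol.fac_large]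
  ring

/-- EACH TERM's SHARP SIBLING WEIGHT (one factor: band × empty sibling × remainder `1`, on the point space) IS AT MOST `1`, for every slot,
threshold, polarity, width. [folklore] -/
theorem toy_sharpSibling_le_one (p : Pol) (u w : ℝ) (σ : Σ _ : ℕ, ℕ) (s : Fin 1 → ℝ) :
    ∑ i ∈ (Finset.range 1).filter (fun _ => (⟨0, 0⟩ : Σ _ : ℕ, ℕ) = σ),
        ∫ _v : Unit, p.shell u 1 (1 / 2) (w * 1) * (∏ j : Fin 1, (if (j : ℕ) = i then (1 : ℝ) else p.fac (smallInd u (s j)))) * (1 : ℝ)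
          ∂(Measure.dirac ()) ≤ 1 := by
  have h01 : ∀ i : ℕ, 0 ≤ ∏ j : Fin 1, (if (j : ℕ) = i then (1 : ℝ) else p.fac (smallInd u (s j))) ∧
      ∏ j : Fin 1, (if (j : ℕ) = i then (1 : ℝ) else p.fac (smallInd u (s j))) ≤ 1 := fun i =>
    prod_ite_fac_smallInd_mem_unitInterval (fun _ : Fin 1 => p) (fun _ => u) s i
  calc ∑ i ∈ (Finset.range 1).filter (fun _ => (⟨0, 0⟩ : Σ _ : ℕ, ℕ) = σ),
        ∫ _v : Unit, p.shell u 1 (1 / 2) (w * 1) * (∏ j : Fin 1, (if (j : ℕ) = i then (1 : ℝ) else p.fac (smallInd u (s j)))) * (1 : ℝ)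
          ∂(Measure.dirac ())
      ≤ ∑ i ∈ Finset.range 1,
        ∫ _v : Unit, p.shell u 1 (1 / 2) (w * 1) * (∏ j : Fin 1, (if (j : ℕ) = i then (1 : ℝ) else p.fac (smallInd u (s j)))) * (1 : ℝ)
          ∂(Measure.dirac ()) := by
        refine Finset.sum_le_sum_of_subset_of_nonneg (Finset.filter_subset _ _) fun i _ _ => ?_
        simp only [integral_dirac, mul_one]
        exact mul_nonneg (Pol.shell_nonneg _ _ _ _ _) (h01 i).1
    _ ≤ 1 := by
        simp only [integral_dirac, mul_one, Finset.sum_range_one]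
        exact mul_le_one₀ (Pol.shell_le_one _ _ _ _ _) (h01 0).1 (h01 0).2

/-- RUN A's REALIZED SHELL PART IN THE `χ`-TERM is `(1∕2)^K∕4 > 0` (the profiled factors are `1∕2` and `1∕2 − (1∕2)^K∕4`; `profile_A`,
`profile_B`). [folklore] -/
theorem toy_shell_true_A (K : ℕ) (t : ℝ) :
    shellW (fun a => linProfile ((fun _ : ℕ => (1 / 2 : ℝ)) a)) (fun _ _ => Measure.dirac ()) (fun _ _ => 1) (fun _ _ _ => ⟨0, 0⟩)
        (fun (_ : ℕ) (b : Bool) (_ : ℕ) => cond b Pol.small Pol.large) (fun _ _ _ => 1) (fun _ _ _ (_ : Unit) => 3 / 4)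
        (fun K _ _ (_ : Unit) => 3 / 4 + (1 / 2 : ℝ) ^ K / 8) (fun _ _ _ (_ : Unit) => 1) K t true = (1 / 2 : ℝ) ^ K / 4 := by
  have hx0 := half_pow_pos K
  have hx1 := half_pow_le_one K
  have hA : linProfile (1 / 2) (3 / 4 / 1) = 1 / 2 := profile_A
  have hB : linProfile (1 / 2) ((3 / 4 + (1 / 2 : ℝ) ^ K / 8) / 1) = 1 / 2 - (1 / 2 : ℝ) ^ K / 4 := profile_B K
  simp only [shellW, integral_dirac, mul_one, Finset.sum_range_one, pieceAt, minPiece, Finset.range_zero, Finset.prod_empty, one_mul,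
    Finset.Ico_self, facAt, Bool.cond_true, Pol.fac_small, hA, hB]
  rw [min_eq_right (by linarith)]
  ring

/-- RUN B's REALIZED SHELL PART IN THE `1 − χ`-TERM is `(1∕2)^K∕4 > 0` (the complementary profiled factors are `1∕2 + (1∕2)^K∕4` and `1∕2`).
[folklore] -/
theorem toy_shell_false_B (K : ℕ) (t : ℝ) :
    shellW (fun a => linProfile ((fun _ : ℕ => (1 / 2 : ℝ)) a)) (fun _ _ => Measure.dirac ()) (fun _ _ => 1) (fun _ _ _ => ⟨0, 0⟩)
        (fun (_ : ℕ) (b : Bool) (_ : ℕ) => cond b Pol.small Pol.large) (fun _ _ _ => 1) (fun K _ _ (_ : Unit) => 3 / 4 + (1 / 2 : ℝ) ^ K / 8)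
        (fun _ _ _ (_ : Unit) => 3 / 4) (fun _ _ _ (_ : Unit) => 1) K t false = (1 / 2 : ℝ) ^ K / 4 := by
  have hx0 := half_pow_pos K
  have hx1 := half_pow_le_one K
  have hA : linProfile (1 / 2) (3 / 4 / 1) = 1 / 2 := profile_A
  have hB : linProfile (1 / 2) ((3 / 4 + (1 / 2 : ℝ) ^ K / 8) / 1) = 1 / 2 - (1 / 2 : ℝ) ^ K / 4 := profile_B K
  simp only [shellW, integral_dirac, mul_one, Finset.sum_range_one, pieceAt, minPiece, Finset.range_zero, Finset.prod_empty, one_mul,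
    Finset.Ico_self, facAt, Bool.cond_false, Pol.fac_large, hA, hB]
  rw [min_eq_right (by linarith)]
  ring

/-- THE BAND WEIGHT of the toy with `Ssup ≡ 2`: `Σ_{a ≤ 0} n_a · lipWeight (κ⁻¹) 2 ρ a K = (1∕2)^K∕2`. [folklore] -/
theorem toy_bandWeight₂ (K : ℕ) :
    ∑ a ∈ Finset.range (0 + 1), ((fun _ : ℕ => (1 : ℕ)) a : ℝ) * lipWeight (fun a => ((fun _ : ℕ => (1 / 2 : ℝ)) a)⁻¹) (fun _ => 2)
      T4LipschitzLedger.Sanity.ρ a K = (1 / 2 : ℝ) ^ K / 2 := by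
  simp only [zero_add, Finset.sum_range_one, Nat.cast_one, one_mul, lipWeight, Nat.zero_le, if_true, T4LipschitzLedger.Sanity.ρ,
    Nat.sub_zero]
  ring

/-- **THE COMMON-BOX SHARP-MIXTURE READING IS INHABITED AND `S_N21` FIRES ON IT.**  There is a carrier predicate `SRec` over `SU(2)` data such
that (i) `SRec` is a COMMON-BOX SHARP-MIXTURE reading predicate — every bundle it pins carries EXACTLY the package of file 10b §2; (ii) it is INHABITED by
the two-term DECOMPOSITION OF UNITY: terms `true ↦ χ`, `false ↦ 1 − χ` of ONE shared occurrence per step (`nC ≡ 1`, `e K τ = id`: BOTH terms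
read the SAME multiplier — the common box is used non-trivially), point space with the Dirac mass, width `κ = 1∕2`, threshold `1`, run A testing
`3∕4`, run B `3∕4 + (1∕2)^K∕8`, remainder `1`; carriers `A ≡ 1∕2`, `B = 1∕2 ∓ (1∕2)^K∕4` ARE the normalised threshold averages of the sharp weights
(`toy_average`); `SupClose` with pv07's width `(1∕2)^j∕8`; the SHARP class total is `1` at EVERY threshold (`toy_sum_sharp`) and each sharp sibling
weight is `≤ 1` (`toy_sharpSibling_le_one`), so the sharp class-relative sibling bound holds with `Ssup ≡ 2` UNIFORMLY over the box; nonempty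
classes, positive carriers, run A's shell part positive in the `χ`-term and run B's in the `1 − χ`-term (`toy_shell_true_A`, `toy_shell_false_B`),
positive record weight `(1∕2)^K∕2`; (iii) `S_N21 SRec` holds (by file 10b §2).  A toy, NOT Bałaban's terms. [folklore] -/
theorem s_N21_fires_on_sharpCommonBoxReading :
    ∃ SRec : SpineRecordPred 2,
      (∃ (F : T4Continuum.T4Family) (D : YMDAG.UVSplit.Datum F 2) (g₀ : ℕ → ℝ) (os : List (T4Continuum.ULoop F))
          (S : SpineCarriers), SRec F D g₀ os S ∧ (∀ K, (S.T K).Nonempty) ∧ (∀ K t τ, 0 < S.A K t τ ∧ 0 < S.B K t τ) ∧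
          (∀ K t, (∃ τ, 0 < S.shA K t τ) ∧ (∃ τ, 0 < S.shB K t τ)) ∧ ∀ K, 0 < S.Wsh K) ∧
      S_N21 SRec := by
  obtain ⟨F, ⟨Dat⟩⟩ := N21AtSpineCarriers.exists_family_and_datum
  have hsumW : Summable fun K : ℕ => (1 / 2 : ℝ) ^ K / 2 :=
    (summable_geometric_of_lt_one (by norm_num) (by norm_num : (1 / 2 : ℝ) < 1)).div_const 2
  refine ⟨_, ?_, s_N21_of_sharpCommonBoxReading (N := 2) _ fun _ _ _ _ _ h => h⟩
  refine ⟨F, Dat, fun _ => 0, [],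
    { ι := Bool, l₀ := 1, vol := 1, K₀ := 0, T := fun _ => Finset.univ, A := fun _ _ _ => 1 / 2,
      B := fun K _ b => cond b (1 / 2 - (1 / 2 : ℝ) ^ K / 4) (1 / 2 + (1 / 2 : ℝ) ^ K / 4),
      shA := shellW (fun a => linProfile ((fun _ : ℕ => (1 / 2 : ℝ)) a)) (fun _ _ => Measure.dirac ()) (fun _ _ => 1)
        (fun _ _ _ => ⟨0, 0⟩) (fun (_ : ℕ) (b : Bool) (_ : ℕ) => cond b Pol.small Pol.large) (fun _ _ _ => 1)
        (fun _ _ _ (_ : Unit) => 3 / 4) (fun K _ _ (_ : Unit) => 3 / 4 + (1 / 2 : ℝ) ^ K / 8) (fun _ _ _ (_ : Unit) => 1),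
      shB := shellW (fun a => linProfile ((fun _ : ℕ => (1 / 2 : ℝ)) a)) (fun _ _ => Measure.dirac ()) (fun _ _ => 1)
        (fun _ _ _ => ⟨0, 0⟩) (fun (_ : ℕ) (b : Bool) (_ : ℕ) => cond b Pol.small Pol.large) (fun _ _ _ => 1)
        (fun K _ _ (_ : Unit) => 3 / 4 + (1 / 2 : ℝ) ^ K / 8) (fun _ _ _ (_ : Unit) => 3 / 4) (fun _ _ _ (_ : Unit) => 1),
      Bad := fun _ _ => ∅, W := fun _ => 0, Wsh := fun K => (1 / 2 : ℝ) ^ K / 2, δ := fun _ => 0 }, ?_, ?_, ?_, ?_, ?_⟩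
  · -- the package of §2 at the toy data
    refine ⟨fun _ _ => Unit, inferInstance, fun _ _ => Measure.dirac (), fun _ _ => inferInstance, fun _ => 1 / 2, 0, fun _ => 1,
      fun _ _ => 1, fun _ _ _ => ⟨0, 0⟩, fun _ b _ => cond b Pol.small Pol.large, fun _ _ _ => 1, fun _ _ _ _ => 3 / 4,
      fun K _ _ _ => 3 / 4 + (1 / 2 : ℝ) ^ K / 8, fun _ _ _ _ => 1, fun _ _ _ _ => 1,
      fun K t b s => ∫ v, (∏ i : Fin 1, (cond b Pol.small Pol.large).fac (smallInd ((fun (_ : Unit) => (3 / 4 : ℝ)) v) (s i))) *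
        (fun (_ : Unit) => (1 : ℝ)) v ∂(Measure.dirac ()),
      fun K t b s => ∫ v, (∏ i : Fin 1, (cond b Pol.small Pol.large).fac
        (smallInd ((fun (_ : Unit) => (3 / 4 + (1 / 2 : ℝ) ^ K / 8)) v) (s i))) * (fun (_ : Unit) => (1 : ℝ)) v ∂(Measure.dirac ()),
      T4LipschitzLedger.Sanity.ρ, fun _ => 2, fun _ => 1, fun _ _ => 0, fun _ _ => 1, fun _ _ j => j,
      fun σ K t b s => ∑ i ∈ (Finset.range 1).filter (fun _ => (⟨0, 0⟩ : Σ _ : ℕ, ℕ) = σ),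
        ∫ v, (cond b Pol.small Pol.large).shell ((fun (_ : Unit) => (3 / 4 : ℝ)) v) 1 (1 / 2)
          (T4LipschitzLedger.Sanity.ρ (K - 0) * 1) *
          (∏ j : Fin 1, (if (j : ℕ) = i then (1 : ℝ) else (cond b Pol.small Pol.large).fac
            (smallInd ((fun (_ : Unit) => (3 / 4 : ℝ)) v) (s j)))) * (fun (_ : Unit) => (1 : ℝ)) v ∂(Measure.dirac ()),
      fun σ K t b s => ∑ i ∈ (Finset.range 1).filter (fun _ => (⟨0, 0⟩ : Σ _ : ℕ, ℕ) = σ),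
        ∫ v, (cond b Pol.small Pol.large).shell ((fun (_ : Unit) => (3 / 4 + (1 / 2 : ℝ) ^ K / 8)) v) 1 (1 / 2)
          (T4LipschitzLedger.Sanity.ρ (K - 0) * 1) *
          (∏ j : Fin 1, (if (j : ℕ) = i then (1 : ℝ) else (cond b Pol.small Pol.large).fac
            (smallInd ((fun (_ : Unit) => (3 / 4 + (1 / 2 : ℝ) ^ K / 8)) v) (s j)))) * (fun (_ : Unit) => (1 : ℝ)) v ∂(Measure.dirac ()),
      fun _ => by norm_num, fun _ _ _ _ _ => by norm_num, fun _ _ _ _ _ => by simp [Finset.mem_sigma], fun _ _ _ _ _ => Nat.zero_le _,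
      fun _ _ _ _ _ => ⟨measurable_const, measurable_const⟩, fun _ _ _ _ _ => ae_of_all _ fun _ => zero_le_one,
      fun _ _ _ _ _ => integrable_const _, fun _ _ _ _ _ => ae_of_all _ fun _ => zero_le_one, fun _ _ _ _ _ => integrable_const _,
      fun _ _ _ _ _ _ => rfl, fun _ _ _ _ _ _ => rfl, ?_, ?_, fun _ _ _ _ _ _ _ => rfl, fun _ _ _ _ _ _ _ => rfl, ?_,
      fun _ _ => one_pos, fun _ _ _ => fun a b h => h, fun _ _ _ _ => rfl, fun _ _ _ _ => rfl, ?_, ?_, fun _ _ => by norm_num,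
      fun j => by unfold T4LipschitzLedger.Sanity.ρ; positivity, summable_ρ, rfl, rfl, fun K => (toy_bandWeight₂ K).le, hsumW⟩
    · -- run A's carriers are the normalised threshold averages
      intro K t _ b _
      show (1 / 2 : ℝ) = (∏ _i : Fin 1, ((1 / 2 : ℝ) * 1))⁻¹ *
        ∫ s : Fin 1 → ℝ, (∫ _v : Unit, (∏ i : Fin 1, (cond b Pol.small Pol.large).fac (smallInd (3 / 4 : ℝ) (s i))) * (1 : ℝ)
          ∂(Measure.dirac ())) ∂(Measure.pi fun _ : Fin 1 => volume.restrict (Icc ((1 - (1 / 2 : ℝ)) * 1) 1))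
      rw [toy_average, profile_A]
      cases b <;> simp only [Bool.cond_true, Bool.cond_false, Pol.fac_small, Pol.fac_large]
      norm_num
    · -- run B's carriers are the normalised threshold averages
      intro K t _ b _
      show cond b (1 / 2 - (1 / 2 : ℝ) ^ K / 4) (1 / 2 + (1 / 2 : ℝ) ^ K / 4) = (∏ _i : Fin 1, ((1 / 2 : ℝ) * 1))⁻¹ *
        ∫ s : Fin 1 → ℝ, (∫ _v : Unit, (∏ i : Fin 1, (cond b Pol.small Pol.large).fac
          (smallInd (3 / 4 + (1 / 2 : ℝ) ^ K / 8) (s i))) * (1 : ℝ) ∂(Measure.dirac ()))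
          ∂(Measure.pi fun _ : Fin 1 => volume.restrict (Icc ((1 - (1 / 2 : ℝ)) * 1) 1))
      rw [toy_average, profile_B]
      cases b <;> simp only [Bool.cond_true, Bool.cond_false, Pol.fac_small, Pol.fac_large]
      ring
    · -- `SupClose` with pv07's width
      intro K b _ i _
      refine ae_of_all _ fun v => ?_
      show |(3 / 4 : ℝ) - (3 / 4 + (1 / 2 : ℝ) ^ K / 8)| ≤ T4LipschitzLedger.Sanity.ρ (K - 0) * 1
      rw [show (3 / 4 : ℝ) - (3 / 4 + (1 / 2 : ℝ) ^ K / 8) = -((1 / 2 : ℝ) ^ K / 8) by ring, abs_neg,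
        abs_of_nonneg (by positivity), T4LipschitzLedger.Sanity.ρ, Nat.sub_zero, mul_one]
    · -- run A: the SHARP class-relative sibling bound at EVERY threshold of the common box, `Ssup ≡ 2`
      intro σ _ K t _ Sv _
      show ∑ b : Bool, ∑ i ∈ (Finset.range 1).filter (fun _ => (⟨0, 0⟩ : Σ _ : ℕ, ℕ) = σ),
          ∫ _v : Unit, (cond b Pol.small Pol.large).shell (3 / 4 : ℝ) 1 (1 / 2) (T4LipschitzLedger.Sanity.ρ (K - 0) * 1) *
            (∏ j : Fin 1, (if (j : ℕ) = i then (1 : ℝ) else (cond b Pol.small Pol.large).fac (smallInd (3 / 4 : ℝ) (Sv j)))) * (1 : ℝ)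
            ∂(Measure.dirac ()) ≤
        2 * ∑ b : Bool, ∫ _v : Unit, (∏ i : Fin 1, (cond b Pol.small Pol.large).fac (smallInd (3 / 4 : ℝ) (Sv i))) * (1 : ℝ)
          ∂(Measure.dirac ())
      have hR : ∑ b : Bool, ∫ _v : Unit, (∏ i : Fin 1, (cond b Pol.small Pol.large).fac (smallInd (3 / 4 : ℝ) (Sv i))) * (1 : ℝ)
          ∂(Measure.dirac ()) = 1 := by
        simp only [integral_dirac, mul_one, Fin.prod_univ_one]
        exact toy_sum_sharp _ _
      rw [hR, Fintype.sum_bool, show (2 : ℝ) * 1 = 2 by norm_num]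
      linarith [toy_sharpSibling_le_one (cond true Pol.small Pol.large) (3 / 4) (T4LipschitzLedger.Sanity.ρ (K - 0)) σ Sv,
        toy_sharpSibling_le_one (cond false Pol.small Pol.large) (3 / 4) (T4LipschitzLedger.Sanity.ρ (K - 0)) σ Sv]
    · -- run B: the same at `u^B`
      intro σ _ K t _ Sv _
      show ∑ b : Bool, ∑ i ∈ (Finset.range 1).filter (fun _ => (⟨0, 0⟩ : Σ _ : ℕ, ℕ) = σ),
          ∫ _v : Unit, (cond b Pol.small Pol.large).shell (3 / 4 + (1 / 2 : ℝ) ^ K / 8) 1 (1 / 2) (T4LipschitzLedger.Sanity.ρ (K - 0) * 1) *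
            (∏ j : Fin 1, (if (j : ℕ) = i then (1 : ℝ) else (cond b Pol.small Pol.large).fac
              (smallInd (3 / 4 + (1 / 2 : ℝ) ^ K / 8) (Sv j)))) * (1 : ℝ) ∂(Measure.dirac ()) ≤
        2 * ∑ b : Bool, ∫ _v : Unit, (∏ i : Fin 1, (cond b Pol.small Pol.large).fac
          (smallInd (3 / 4 + (1 / 2 : ℝ) ^ K / 8) (Sv i))) * (1 : ℝ) ∂(Measure.dirac ())
      have hR : ∑ b : Bool, ∫ _v : Unit, (∏ i : Fin 1, (cond b Pol.small Pol.large).fac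
          (smallInd (3 / 4 + (1 / 2 : ℝ) ^ K / 8) (Sv i))) * (1 : ℝ) ∂(Measure.dirac ()) = 1 := by
        simp only [integral_dirac, mul_one, Fin.prod_univ_one]
        exact toy_sum_sharp _ _
      rw [hR, Fintype.sum_bool, show (2 : ℝ) * 1 = 2 by norm_num]
      linarith [toy_sharpSibling_le_one (cond true Pol.small Pol.large) (3 / 4 + (1 / 2 : ℝ) ^ K / 8)
          (T4LipschitzLedger.Sanity.ρ (K - 0)) σ Sv,
        toy_sharpSibling_le_one (cond false Pol.small Pol.large) (3 / 4 + (1 / 2 : ℝ) ^ K / 8) (T4LipschitzLedger.Sanity.ρ (K - 0)) σ Sv]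
  · intro K
    exact ⟨true, Finset.mem_univ _⟩
  · intro K t b
    refine ⟨by norm_num, ?_⟩
    have hx0 := half_pow_pos K
    have hx1 := half_pow_le_one K
    cases b <;> simp only [Bool.cond_true, Bool.cond_false] <;> linarith
  · intro K t
    exact ⟨⟨true, lt_of_lt_of_eq (by positivity : (0 : ℝ) < (1 / 2 : ℝ) ^ K / 4) (toy_shell_true_A K t).symm⟩,
      ⟨false, lt_of_lt_of_eq (by positivity : (0 : ℝ) < (1 / 2 : ℝ) ^ K / 4) (toy_shell_false_B K t).symm⟩⟩
  · intro K
    positivity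

end NonVacuity

end Summit.QuantumFields.YangMills.Theorems.N21AtSpineCarriersMixtureCommonBoxSanity

end
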